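import Summits.CriticalPhenomena.PercolationContinuityZ3.Theorems.PercNearOneGluingNoHeavyConstsMDLXJointMarkerPair
import Summits.CriticalPhenomena.PercolationContinuityZ3.Theorems.PercNearOneGluingNoHeavyConstsConditionedMarker
import Literature.Probability.Percolation.TwoSetConditionalAssociation
import Literature.Probability.Percolation.TwoClusterConditionalAssociation
import HarnessLib

/-!
# MDL(X)′ for every functional supported on the marker event `{s ↔ y}` — the fourth pinned quadrant
# (PAPER-2 track (ii): constants of the CSH family; seat `prim-consts-2`, gen 17)

builds on p205010 (kernel theorem, internal audit signed; external expert review pending).  Support file (`--supports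
stmt-CriticalPhenomena-4575`); memo `run/shared/lean/prim/consts/FROM-prim-consts-2-g17-CYLINDER-DUALITY.md` §2.  No definitions, no named facts,
no sorries; standard axioms.

Notation (as in `…ConstsMDLXJoint.lean`): owner `s`, avoided set `X`, markers `y ≠ s`, `z`; `D = {s ↮ X}`, `T = {y ↮ {s}∪X} ∩ D`, `W = {y ↔ z}`,
`Y = {s ↔ y}`, `N = Yᶜ`, `Z = {s ↔ z}`, `E₁ = {s ↮ X} ∩ {y ↮ X}` (so `E₁ ∩ Y = D ∩ Y`, `E₁ ∩ N = T`), `K = C_s ∪ C_y` the open edge cluster of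
the pair `{s,y}`, `ν = μ(·|D)`, `p' = μ(T∩W)/μ(T)`, `κ = P(z ∈ V(K) | E₁)`.

* `Consts.mdlxJoint_of_eq_off_marker` — **THEOREM: the `Consts.MDLXJoint` inequality holds, in every finite weighted graph, at every monotone
  `F` supported on `{y ∈ V(C_s)}`** (`F(C) = F(∅)` unless `y = s` or some pair of `C` contains `y`): the indicators of all up-events `U ⊆ {s↔y}` —
  `{s↔y} ∩ {s↔b}` for a fifth vertex `b`, every cylinder `1{C₀ ⊆ C_s}` whose pattern reaches `y` (in particular the marker-pair cylinder of
  `Consts.mdlxJoint_markerPair`), `1{s↔y}·G` for monotone `G ≥ 0`.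
  PROOF.  After subtracting `F(∅)`: `F ≥ 0` vanishes off `Y`, `I := ∫_D F = ∫_{D∩Y} F`, and the `Y`-bracket is `I·μ(D∩N)`.  (1) On `D`,
  `F(C_s) = F(K)·1{s↔y in K}` is an increasing functional of `K`, as is `1{z ∈ V(K)}`; van den Berg–Häggström–Kahn's Theorem 1.3 WITH VERTEX SETS
  (source `{s,y}` repelled from `X`, `BHK2006_setClusterConditionalPositiveAssociation`) gives `μ(E₁)·∫_{D∩Z} F ≥ I·μ(E₁ ∩ {z ∈ V(K)})`, and
  `E₁ ∩ {z∈V(K)} = (E₁∩Z) ⊔ (T∩W)` (`Consts.avoidBoth_inter_reach_union_eq`).  (2) The remaining inequality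
  `μ(T)[μ(D)(μ(E₁∩Z)+μ(T∩W)) − μ(E₁)μ(D∩Z)] ≥ μ(T∩W)μ(E₁)μ(D∩N)` is IDENTICAL (via `E₁ = (E₁∩Y) ⊔ T`) to the dual corner
  `Consts.mdlxJ2_at_yAvoid` (J2 at `g = 1{y ↮ X}`, gen 12).  In words: `ν(Z | U) ≥ κ ≥ ν(Z) + p'·ν(N)` for every up-event `U ⊆ Y`.
  With `Consts.mdlxJoint_of_lowerMarker_le` ⊇ `{U ⊇ Y}` (gen 16), `Consts.mdlxJoint_of_eq_off_reach` (`U ⊆ Z`) and `Consts.mdlxJoint_of_eq_on_reach`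
  (`U ⊇ Z`) ALL FOUR PINNED QUADRANTS of up-events are now theorems; the open core of `Consts.MDLXJoint` is the class of up-events comparable with
  neither `{s↔y}` nor `{s↔z}` (e.g. `{s↔b}` for a fifth vertex, the pair form at a pair `s(s,u)`, `u ∉ {y,z}`).
* `Consts.mdlxJoint_markerMul` — the instance `F = 1{s↔y}·G` (`G ≥ 0` monotone); `Consts.mdlxJoint_markerInter` — `F = 1{s↔y}·1{s↔b}`.
[cite: VandenbergHaggstromKahn2005, Thm. 1.3 (p. 6), Thm. 1.4 (p. 7) with Remark 1 after Thm. 1.2 (p. 5)]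
-/

noncomputable section

namespace Summit.CriticalPhenomena.PercolationContinuityZ3.Theorems

open MeasureTheory Set Literature.Probability.LatticeModels Literature.Probability.Percolation
open scoped Classical

namespace Consts

variable {V : Type*} [Fintype V]

/-- Real-arithmetic core of `Consts.mdlxJoint_of_eq_off_marker`: the J2 corner (`key`), the positive-association step (`pa`) and the two mass
splits give the `Consts.MDLXJoint` inequality for a functional supported on `{s↔y}`. [folklore] -/
theorem markerPinned_core (t tw d d1 d1y d1z dy dyc dz i q : ℝ) (ht : 0 ≤ t) (hd : 0 ≤ d) (hi : 0 ≤ i) (hd1 : 0 < d1)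
    (key : tw * (d * d1y - d1 * dy) ≤ t * (d * d1z - d1 * dz)) (pa : i * (d1z + tw) ≤ d1 * q)
    (hsplitY : d1 = d1y + t) (hsplitD : dy + dyc = d) :
    tw * (i * dyc) ≤ t * (d * q - i * dz) := by
  have h2 : t * d * (i * (d1z + tw)) ≤ t * d * (d1 * q) := mul_le_mul_of_nonneg_left pa (mul_nonneg ht hd)
  have h3 : i * (tw * (d * d1y - d1 * dy)) ≤ i * (t * (d * d1z - d1 * dz)) := mul_le_mul_of_nonneg_left key hi
  have hprod : d1 * (tw * (i * dyc)) ≤ d1 * (t * (d * q - i * dz)) := by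
    linear_combination h2 + h3 + (i * tw * d1) * hsplitD + (i * tw * d) * hsplitY
  exact le_of_mul_le_mul_left hprod hd1

/-- **MDL(X)′ AT EVERY FUNCTIONAL SUPPORTED ON `{s ↔ y}`.**  For all weights, owner `s`, avoided set `X`, markers `y`, `z`, and every monotone
functional `F` of the open edge cluster of `s` with `F(C) = F(∅)` unless `y = s` or some pair of `C` contains `y`, the `Consts.MDLXJoint`
inequality holds:
`μ(T∩W)·[μ(D)∫_{D∩Y}F(C_s) − (∫_D F(C_s))μ(D∩Y)] ≤ μ(T)·[μ(D)∫_{D∩Z}F(C_s) − (∫_D F(C_s))μ(D∩Z)]`.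
[cite: VandenbergHaggstromKahn2005, Thm. 1.3 (p. 6), Thm. 1.4 (p. 7) with Remark 1 after Thm. 1.2 (p. 5)] -/
theorem mdlxJoint_of_eq_off_marker (w : Sym2 V → unitInterval) (s y z : V) (X : Set V)
    (F : Set (Sym2 V) → ℝ) (hF : Monotone F)
    (hFy : ∀ C : Set (Sym2 V), ¬ (y = s ∨ ∃ e ∈ C, y ∈ e) → F C = F ∅) :
    (prodBernoulli w).real ({ω : BondConfig V | ∀ x ∈ insert s X, ¬ (openGraph ω).Reachable y x} ∩
          {ω | ∀ x ∈ X, ¬ (openGraph ω).Reachable s x} ∩ openConn y z) *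
        ((prodBernoulli w).real {ω : BondConfig V | ∀ x ∈ X, ¬ (openGraph ω).Reachable s x} *
            (∫ ω in {ω : BondConfig V | ∀ x ∈ X, ¬ (openGraph ω).Reachable s x} ∩ openConn s y,
              F (openEdgeCluster ω s) ∂(prodBernoulli w)) -
          (∫ ω in {ω : BondConfig V | ∀ x ∈ X, ¬ (openGraph ω).Reachable s x},
              F (openEdgeCluster ω s) ∂(prodBernoulli w)) *
            (prodBernoulli w).real ({ω : BondConfig V | ∀ x ∈ X, ¬ (openGraph ω).Reachable s x} ∩ openConn s y)) ≤
      (prodBernoulli w).real ({ω : BondConfig V | ∀ x ∈ insert s X, ¬ (openGraph ω).Reachable y x} ∩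
          {ω | ∀ x ∈ X, ¬ (openGraph ω).Reachable s x}) *
        ((prodBernoulli w).real {ω : BondConfig V | ∀ x ∈ X, ¬ (openGraph ω).Reachable s x} *
            (∫ ω in {ω : BondConfig V | ∀ x ∈ X, ¬ (openGraph ω).Reachable s x} ∩ openConn s z,
              F (openEdgeCluster ω s) ∂(prodBernoulli w)) -
          (∫ ω in {ω : BondConfig V | ∀ x ∈ X, ¬ (openGraph ω).Reachable s x},
              F (openEdgeCluster ω s) ∂(prodBernoulli w)) *
            (prodBernoulli w).real ({ω : BondConfig V | ∀ x ∈ X, ¬ (openGraph ω).Reachable s x} ∩ openConn s z)) := by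
  classical
  set μ := prodBernoulli w with hμ
  have hmeas : ∀ S : Set (BondConfig V), MeasurableSet S := fun _ => MeasurableSet.of_discrete
  set D : Set (BondConfig V) := {ω | ∀ x ∈ X, ¬ (openGraph ω).Reachable s x} with hD
  set D₁ : Set (BondConfig V) := {ω : BondConfig V | ∀ x ∈ X, ¬ (openGraph ω).Reachable s x ∧ ¬ (openGraph ω).Reachable y x}
    with hD₁
  set TW : Set (BondConfig V) := {ω : BondConfig V | ∀ x ∈ insert s X, ¬ (openGraph ω).Reachable y x} ∩ D ∩ openConn y z
    with hTW
  set T : Set (BondConfig V) := {ω : BondConfig V | ∀ x ∈ insert s X, ¬ (openGraph ω).Reachable y x} ∩ D with hT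
  set Yv : Set (BondConfig V) := openConn s y with hYv
  set Zv : Set (BondConfig V) := openConn s z with hZv
  set Wv : Set (BondConfig V) := openConn y z with hWv
  set c : ℝ := F ∅ with hc
  set f : BondConfig V → ℝ := fun ω => F (openEdgeCluster ω s) with hf
  set g : BondConfig V → ℝ := fun ω => f ω - c with hg
  have hg0 : ∀ ω, 0 ≤ g ω := fun ω => sub_nonneg.2 (hF (empty_subset _))
  have hgY : ∀ ω, ω ∉ Yv → g ω = 0 := by
    intro ω hω
    have hno : ¬ (y = s ∨ ∃ e ∈ openEdgeCluster ω s, y ∈ e) := fun h =>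
      hω ((reachable_iff_exists_mem_openEdgeCluster ω s y).2 h)
    show F (openEdgeCluster ω s) - F ∅ = 0
    rw [hFy _ hno, sub_self]
  -- integrals of `f` versus `g`
  have hfg : ∀ S : Set (BondConfig V), ∫ ω in S, f ω ∂μ = (∫ ω in S, g ω ∂μ) + c * μ.real S := by
    intro S
    have : (fun ω => f ω) = fun ω => g ω + c := by funext ω; simp [hg]
    rw [this, integral_add Integrable.of_finite Integrable.of_finite, setIntegral_const, smul_eq_mul, mul_comm]
  set I := ∫ ω in D, g ω ∂μ with hI
  have hI0 : 0 ≤ I := setIntegral_nonneg (hmeas D) fun ω _ => hg0 ω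
  -- `g` vanishes off `Y`: restricted integrals
  have hvan : ∀ S : Set (BondConfig V), ∫ ω in S ∩ Yvᶜ, g ω ∂μ = 0 :=
    fun S => setIntegral_eq_zero_of_forall_eq_zero fun ω hω => hgY ω hω.2
  have hIY : ∫ ω in D ∩ Yv, g ω ∂μ = I := by
    have h := setIntegral_inter_add_compl w D Yv g
    rw [hvan D, add_zero] at h
    exact h
  have hIZ : ∫ ω in D ∩ Zv, g ω ∂μ = ∫ ω in D ∩ Yv ∩ Zv, g ω ∂μ := by
    have h := setIntegral_inter_add_compl w (D ∩ Zv) Yv g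
    rw [hvan (D ∩ Zv), add_zero, inter_right_comm] at h
    exact h.symm
  -- the brackets are shift invariant
  have hbY : μ.real D * (∫ ω in D ∩ Yv, f ω ∂μ) - (∫ ω in D, f ω ∂μ) * μ.real (D ∩ Yv) = I * μ.real (D ∩ Yvᶜ) := by
    rw [hfg (D ∩ Yv), hfg D, hIY]
    have hsplit : μ.real (D ∩ Yv) + μ.real (D ∩ Yvᶜ) = μ.real D := by
      have h := measureReal_inter_add_sdiff (μ := μ) (s := D) (hmeas Yv)
      rwa [Set.sdiff_eq] at h
    rw [← hsplit]; ring
  have hbZ : μ.real D * (∫ ω in D ∩ Zv, f ω ∂μ) - (∫ ω in D, f ω ∂μ) * μ.real (D ∩ Zv) =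
      μ.real D * (∫ ω in D ∩ Yv ∩ Zv, g ω ∂μ) - I * μ.real (D ∩ Zv) := by
    rw [hfg (D ∩ Zv), hfg D, hIZ]; ring
  change μ.real TW * (μ.real D * (∫ ω in D ∩ Yv, f ω ∂μ) - (∫ ω in D, f ω ∂μ) * μ.real (D ∩ Yv)) ≤
    μ.real T * (μ.real D * (∫ ω in D ∩ Zv, f ω ∂μ) - (∫ ω in D, f ω ∂μ) * μ.real (D ∩ Zv))
  rw [hbY, hbZ]
  -- (1) BHK Thm 1.3 with sets for the source `{s,y}` repelled from `X`:  μ(D₁) ∫_{D∩Y∩Z} g ≥ I · μ(D₁ ∩ ({s↔z} ∪ {y↔z}))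
  have hE₁ : {ω : BondConfig V | ∀ a ∈ ({s, y} : Set V), ∀ t ∈ X, ¬ (openGraph ω).Reachable a t} = D₁ := by
    ext ω
    simp only [hD₁, mem_setOf_eq, mem_insert_iff, mem_singleton_iff, forall_eq_or_imp, forall_eq]
    exact ⟨fun h x hx => ⟨h.1 x hx, h.2 x hx⟩, fun h => ⟨fun x hx => (h x hx).1, fun x hx => (h x hx).2⟩⟩
  set F₁ : Set (Sym2 V) → ℝ := fun C => (F C - F ∅) * (if (openGraph C).Reachable s y then 1 else 0) with hF₁
  set G₂ : Set (Sym2 V) → ℝ := fun C => if (z = s ∨ z = y ∨ ∃ e ∈ C, z ∈ e) then 1 else 0 with hG₂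
  have hF₁m : Monotone F₁ := by
    intro C C' hCC'
    have h1 : F C - F ∅ ≤ F C' - F ∅ := sub_le_sub_right (hF hCC') _
    have h0 : 0 ≤ F C - F ∅ := sub_nonneg.2 (hF (empty_subset _))
    have h2 : (if (openGraph C).Reachable s y then (1 : ℝ) else 0) ≤ (if (openGraph C').Reachable s y then 1 else 0) := by
      by_cases h : (openGraph C).Reachable s y
      · rw [if_pos h, if_pos (h.mono (openGraph_mono hCC'))]
      · rw [if_neg h]; split_ifs <;> norm_num
    have h3 : (0 : ℝ) ≤ (if (openGraph C).Reachable s y then (1 : ℝ) else 0) := by split_ifs <;> norm_num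
    exact mul_le_mul h1 h2 h3 (h0.trans h1)
  have hG₂m : Monotone G₂ := by
    refine TripodExchange.predIndicator_monotone ?_
    rintro C C' hCC' (h | h | ⟨e, he, hze⟩)
    · exact Or.inl h
    · exact Or.inr (Or.inl h)
    · exact Or.inr (Or.inr ⟨e, hCC' he, hze⟩)
  -- reading the two functionals on the cluster of `{s,y}`
  have hK : ∀ ω : BondConfig V, (⋃ a ∈ ({s, y} : Set V), openEdgeCluster ω a) = openEdgeCluster ω s ∪ openEdgeCluster ω y := by
    intro ω; ext e; simp
  have hF₁ω : ∀ ω : BondConfig V, F₁ (⋃ a ∈ ({s, y} : Set V), openEdgeCluster ω a) = g ω := by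
    intro ω
    have hiff : (openGraph (⋃ a ∈ ({s, y} : Set V), openEdgeCluster ω a)).Reachable s y ↔ (openGraph ω).Reachable s y :=
      (KNSep.reachable_iff_cluster ω ({s, y} : Set V) (mem_insert s {y}) y).symm
    by_cases hY : (openGraph ω).Reachable s y
    · -- on `{s ↔ y}` the cluster of the pair is the cluster of `s`
      have hKeq : (⋃ a ∈ ({s, y} : Set V), openEdgeCluster ω a) = openEdgeCluster ω s := by
        rw [hK]
        refine union_eq_left.2 fun e he => ?_
        rcases (mem_openEdgeCluster_iff ω y e).1 he with ⟨heo, hed, hr⟩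
        exact (mem_openEdgeCluster_iff ω s e).2 ⟨heo, hed, fun v hv => hY.trans (hr v hv)⟩
      have hr : (openGraph (⋃ a ∈ ({s, y} : Set V), openEdgeCluster ω a)).Reachable s y := hiff.2 hY
      show (F _ - F ∅) * (if (openGraph (⋃ a ∈ ({s, y} : Set V), openEdgeCluster ω a)).Reachable s y then (1 : ℝ) else 0) = g ω
      rw [if_pos hr, mul_one, hKeq]
    · have hg0' : g ω = 0 := hgY ω hY
      have hr : ¬ (openGraph (⋃ a ∈ ({s, y} : Set V), openEdgeCluster ω a)).Reachable s y := fun h => hY (hiff.1 h)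
      show (F _ - F ∅) * (if (openGraph (⋃ a ∈ ({s, y} : Set V), openEdgeCluster ω a)).Reachable s y then (1 : ℝ) else 0) = g ω
      rw [if_neg hr, mul_zero, hg0']
  have hG₂ω : ∀ ω : BondConfig V, G₂ (⋃ a ∈ ({s, y} : Set V), openEdgeCluster ω a) = (Zv ∪ Wv).indicator 1 ω := by
    intro ω
    have hiff : (z = s ∨ z = y ∨ ∃ e ∈ (⋃ a ∈ ({s, y} : Set V), openEdgeCluster ω a), z ∈ e) ↔ ω ∈ Zv ∪ Wv := by
      rw [hK]
      constructor
      · rintro (h | h | ⟨e, he, hze⟩)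
        · exact Or.inl ((reachable_iff_exists_mem_openEdgeCluster ω s z).2 (Or.inl h))
        · exact Or.inr ((reachable_iff_exists_mem_openEdgeCluster ω y z).2 (Or.inl h))
        · rcases he with he | he
          · exact Or.inl ((reachable_iff_exists_mem_openEdgeCluster ω s z).2 (Or.inr ⟨e, he, hze⟩))
          · exact Or.inr ((reachable_iff_exists_mem_openEdgeCluster ω y z).2 (Or.inr ⟨e, he, hze⟩))
      · rintro (h | h)
        · rcases (reachable_iff_exists_mem_openEdgeCluster ω s z).1 h with h' | ⟨e, he, hze⟩
          · exact Or.inl h'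
          · exact Or.inr (Or.inr ⟨e, Or.inl he, hze⟩)
        · rcases (reachable_iff_exists_mem_openEdgeCluster ω y z).1 h with h' | ⟨e, he, hze⟩
          · exact Or.inr (Or.inl h')
          · exact Or.inr (Or.inr ⟨e, Or.inr he, hze⟩)
    simp only [hG₂, hiff]
    exact TwoSetConditionalAssociation.predIndicator_eq_indicator (fun ω' => ω' ∈ Zv ∪ Wv) ω
  have pa := BHK2006_setClusterConditionalPositiveAssociation w ({s, y} : Set V) X F₁ G₂ hF₁m hG₂m
  simp only [hF₁ω, hG₂ω, hE₁] at pa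
  -- pa : (∫_{D₁} g) * (∫_{D₁} 1_{Z∪W}) ≤ μ(D₁) * ∫_{D₁} g * 1_{Z∪W}
  have hgD₁ : ∫ ω in D₁, g ω ∂μ = I := by
    have h1 : D₁ ∩ Yv = D ∩ Yv := by
      ext ω
      simp only [hD₁, hD, hYv, openConn, mem_inter_iff, mem_setOf_eq]
      constructor
      · rintro ⟨h, hy⟩; exact ⟨fun x hx => (h x hx).1, hy⟩
      · rintro ⟨h, hy⟩; exact ⟨fun x hx => ⟨h x hx, fun hyx => h x hx (hy.trans hyx)⟩, hy⟩
    have h := setIntegral_inter_add_compl w D₁ Yv g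
    rw [hvan D₁, add_zero, h1, hIY] at h
    exact h.symm
  have hind : ∫ ω in D₁, (Zv ∪ Wv).indicator (1 : BondConfig V → ℝ) ω ∂μ = μ.real (D₁ ∩ (Zv ∪ Wv)) :=
    TripodExchange.setIntegral_indicator_one_eq w D₁ (Zv ∪ Wv)
  have hprod : ∫ ω in D₁, g ω * (Zv ∪ Wv).indicator (1 : BondConfig V → ℝ) ω ∂μ = ∫ ω in D ∩ Yv ∩ Zv, g ω ∂μ := by
    have e1 : (fun ω => g ω * (Zv ∪ Wv).indicator (1 : BondConfig V → ℝ) ω) = (Zv ∪ Wv).indicator g := by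
      funext ω
      by_cases hω : ω ∈ Zv ∪ Wv
      · rw [indicator_of_mem hω, indicator_of_mem hω, Pi.one_apply, mul_one]
      · rw [indicator_of_notMem hω, indicator_of_notMem hω, mul_zero]
    rw [e1, setIntegral_indicator (hmeas _)]
    -- `D₁ ∩ (Z ∪ W)` versus `D ∩ Y ∩ Z`: `g` vanishes off `Y`, and on `Y`, `Z ∪ W = Z`, `D₁ = D`
    have h2 : ∫ ω in D₁ ∩ (Zv ∪ Wv), g ω ∂μ = ∫ ω in D₁ ∩ (Zv ∪ Wv) ∩ Yv, g ω ∂μ := by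
      have h := setIntegral_inter_add_compl w (D₁ ∩ (Zv ∪ Wv)) Yv g
      rw [hvan, add_zero] at h
      exact h.symm
    have h3 : D₁ ∩ (Zv ∪ Wv) ∩ Yv = D ∩ Yv ∩ Zv := by
      ext ω
      simp only [hD₁, hD, hYv, hZv, hWv, openConn, mem_inter_iff, mem_union, mem_setOf_eq]
      constructor
      · rintro ⟨⟨h, hzw⟩, hy⟩
        refine ⟨⟨fun x hx => (h x hx).1, hy⟩, ?_⟩
        rcases hzw with hz | hw
        · exact hz
        · exact hy.trans hw
      · rintro ⟨⟨h, hy⟩, hz⟩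
        exact ⟨⟨fun x hx => ⟨h x hx, fun hyx => h x hx (hy.trans hyx)⟩, Or.inl hz⟩, hy⟩
    rw [h2, h3]
  rw [hgD₁, hind, hprod] at pa
  -- (2) the split `D₁ ∩ (Z ∪ W) = (D₁ ∩ Z) ⊔ (T ∩ W)` and `D₁ = (D₁ ∩ Y) ⊔ T`
  have hsplitZ : μ.real (D₁ ∩ (Zv ∪ Wv)) = μ.real (D₁ ∩ Zv) + μ.real TW := by
    rw [avoidBoth_inter_reach_union_eq s y z X]
    exact measureReal_union (disjoint_avoidBoth_reach_T s y z X) (hmeas _)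
  have hsplitY : μ.real D₁ = μ.real (D₁ ∩ Yv) + μ.real T := by
    have h := measureReal_union (μ := μ) (disjoint_avoidBoth_reachY_T s y X) (hmeas _)
    rw [← avoidBoth_eq_inter_reach_union_T s y X] at h
    exact h
  rw [hsplitZ] at pa
  -- (3) the dual corner J2 at `g = 1{y ↮ X}`
  have key := mdlxJ2_at_yAvoid w s y z X
  rw [← avoidBoth_eq_inter s y X] at key
  -- masses
  have hsplitD : μ.real (D ∩ Yv) + μ.real (D ∩ Yvᶜ) = μ.real D := by
    have h := measureReal_inter_add_sdiff (μ := μ) (s := D) (hmeas Yv)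
    rwa [Set.sdiff_eq] at h
  have hT0 : 0 ≤ μ.real T := measureReal_nonneg
  have hTW0 : 0 ≤ μ.real TW := measureReal_nonneg
  have hD0 : 0 ≤ μ.real D := measureReal_nonneg
  have hD₁0 : 0 ≤ μ.real D₁ := measureReal_nonneg
  have hTle : μ.real T ≤ μ.real D₁ := by
    rw [hsplitY]; linarith [measureReal_nonneg (μ := μ) (s := D₁ ∩ Yv)]
  have hTWle : μ.real TW ≤ μ.real T := measureReal_mono inter_subset_left
  -- if `μ(D₁) = 0` everything vanishes; else the real-arithmetic core
  by_cases hD₁z : μ.real D₁ = 0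
  · have hT' : μ.real T = 0 := le_antisymm (hD₁z ▸ hTle) hT0
    have hTW' : μ.real TW = 0 := le_antisymm (hT' ▸ hTWle) hTW0
    rw [hT', hTW', zero_mul, zero_mul]
  have hD₁pos : 0 < μ.real D₁ := lt_of_le_of_ne hD₁0 (Ne.symm hD₁z)
  exact markerPinned_core (μ.real T) (μ.real TW) (μ.real D) (μ.real D₁) (μ.real (D₁ ∩ Yv)) (μ.real (D₁ ∩ Zv))
    (μ.real (D ∩ Yv)) (μ.real (D ∩ Yvᶜ)) (μ.real (D ∩ Zv)) I (∫ ω in D ∩ Yv ∩ Zv, g ω ∂μ) hT0 hD0 hI0 hD₁pos key pa hsplitY hsplitD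

/-- **Instance: `F = 1{s ↔ y} · G`** for a monotone `G ≥ 0`: the `Consts.MDLXJoint` inequality holds at `C ↦ connIndicatorFn s y C · G C`.
[cite: VandenbergHaggstromKahn2005, Thm. 1.3 (p. 6)] -/
theorem mdlxJoint_markerMul (w : Sym2 V → unitInterval) (s y z : V) (X : Set V)
    (G : Set (Sym2 V) → ℝ) (hG : Monotone G) (hG0 : ∀ C, 0 ≤ G C) :
    (prodBernoulli w).real ({ω : BondConfig V | ∀ x ∈ insert s X, ¬ (openGraph ω).Reachable y x} ∩
          {ω | ∀ x ∈ X, ¬ (openGraph ω).Reachable s x} ∩ openConn y z) *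
        ((prodBernoulli w).real {ω : BondConfig V | ∀ x ∈ X, ¬ (openGraph ω).Reachable s x} *
            (∫ ω in {ω : BondConfig V | ∀ x ∈ X, ¬ (openGraph ω).Reachable s x} ∩ openConn s y,
              connIndicatorFn s y (openEdgeCluster ω s) * G (openEdgeCluster ω s) ∂(prodBernoulli w)) -
          (∫ ω in {ω : BondConfig V | ∀ x ∈ X, ¬ (openGraph ω).Reachable s x},
              connIndicatorFn s y (openEdgeCluster ω s) * G (openEdgeCluster ω s) ∂(prodBernoulli w)) *
            (prodBernoulli w).real ({ω : BondConfig V | ∀ x ∈ X, ¬ (openGraph ω).Reachable s x} ∩ openConn s y)) ≤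
      (prodBernoulli w).real ({ω : BondConfig V | ∀ x ∈ insert s X, ¬ (openGraph ω).Reachable y x} ∩
          {ω | ∀ x ∈ X, ¬ (openGraph ω).Reachable s x}) *
        ((prodBernoulli w).real {ω : BondConfig V | ∀ x ∈ X, ¬ (openGraph ω).Reachable s x} *
            (∫ ω in {ω : BondConfig V | ∀ x ∈ X, ¬ (openGraph ω).Reachable s x} ∩ openConn s z,
              connIndicatorFn s y (openEdgeCluster ω s) * G (openEdgeCluster ω s) ∂(prodBernoulli w)) -
          (∫ ω in {ω : BondConfig V | ∀ x ∈ X, ¬ (openGraph ω).Reachable s x},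
              connIndicatorFn s y (openEdgeCluster ω s) * G (openEdgeCluster ω s) ∂(prodBernoulli w)) *
            (prodBernoulli w).real ({ω : BondConfig V | ∀ x ∈ X, ¬ (openGraph ω).Reachable s x} ∩ openConn s z)) := by
  classical
  have hmono : Monotone (fun C : Set (Sym2 V) => connIndicatorFn s y C * G C) := by
    intro C C' hCC'
    have h1 := monotone_connIndicatorFn s y hCC'
    have hc0 : 0 ≤ connIndicatorFn s y C := by unfold connIndicatorFn; split_ifs <;> norm_num
    exact mul_le_mul h1 (hG hCC') (hG0 C) (hc0.trans h1)
  have hvan : ∀ C : Set (Sym2 V), ¬ (y = s ∨ ∃ e ∈ C, y ∈ e) → connIndicatorFn s y C * G C = connIndicatorFn s y ∅ * G ∅ := by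
    intro C hC
    have h1 : connIndicatorFn s y C = 0 := by unfold connIndicatorFn; rw [if_neg hC]
    have h2 : connIndicatorFn s y (∅ : Set (Sym2 V)) = 0 := by
      unfold connIndicatorFn
      rw [if_neg]
      rintro (h | ⟨e, he, -⟩)
      · exact hC (Or.inl h)
      · exact he
    rw [h1, h2, zero_mul, zero_mul]
  exact mdlxJoint_of_eq_off_marker w s y z X _ hmono hvan

/-- **Instance: the up-event `{s↔y} ∩ {s↔b}`** (`F = 1{s↔y}·1{s↔b}`, any fifth vertex `b`): the `Consts.MDLXJoint` inequality holds at it in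
every weighted graph. [cite: VandenbergHaggstromKahn2005, Thm. 1.3 (p. 6)] -/
theorem mdlxJoint_markerInter (w : Sym2 V → unitInterval) (s y z b : V) (X : Set V) :
    (prodBernoulli w).real ({ω : BondConfig V | ∀ x ∈ insert s X, ¬ (openGraph ω).Reachable y x} ∩
          {ω | ∀ x ∈ X, ¬ (openGraph ω).Reachable s x} ∩ openConn y z) *
        ((prodBernoulli w).real {ω : BondConfig V | ∀ x ∈ X, ¬ (openGraph ω).Reachable s x} *
            (∫ ω in {ω : BondConfig V | ∀ x ∈ X, ¬ (openGraph ω).Reachable s x} ∩ openConn s y,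
              connIndicatorFn s y (openEdgeCluster ω s) * connIndicatorFn s b (openEdgeCluster ω s) ∂(prodBernoulli w)) -
          (∫ ω in {ω : BondConfig V | ∀ x ∈ X, ¬ (openGraph ω).Reachable s x},
              connIndicatorFn s y (openEdgeCluster ω s) * connIndicatorFn s b (openEdgeCluster ω s) ∂(prodBernoulli w)) *
            (prodBernoulli w).real ({ω : BondConfig V | ∀ x ∈ X, ¬ (openGraph ω).Reachable s x} ∩ openConn s y)) ≤
      (prodBernoulli w).real ({ω : BondConfig V | ∀ x ∈ insert s X, ¬ (openGraph ω).Reachable y x} ∩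
          {ω | ∀ x ∈ X, ¬ (openGraph ω).Reachable s x}) *
        ((prodBernoulli w).real {ω : BondConfig V | ∀ x ∈ X, ¬ (openGraph ω).Reachable s x} *
            (∫ ω in {ω : BondConfig V | ∀ x ∈ X, ¬ (openGraph ω).Reachable s x} ∩ openConn s z,
              connIndicatorFn s y (openEdgeCluster ω s) * connIndicatorFn s b (openEdgeCluster ω s) ∂(prodBernoulli w)) -
          (∫ ω in {ω : BondConfig V | ∀ x ∈ X, ¬ (openGraph ω).Reachable s x},
              connIndicatorFn s y (openEdgeCluster ω s) * connIndicatorFn s b (openEdgeCluster ω s) ∂(prodBernoulli w)) *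
            (prodBernoulli w).real ({ω : BondConfig V | ∀ x ∈ X, ¬ (openGraph ω).Reachable s x} ∩ openConn s z)) :=
  mdlxJoint_markerMul w s y z X (connIndicatorFn s b) (monotone_connIndicatorFn s b)
    (fun C => by unfold connIndicatorFn; split_ifs <;> norm_num)

end Consts

end Summit.CriticalPhenomena.PercolationContinuityZ3.Theorems

end
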